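import Summits.QuantumFields.YangMills.Theorems.UnitScaleTiltProp7OneFormGreenSupRowsFamily
import Summits.QuantumFields.YangMills.Theorems.UnitScaleTiltProp7OneFormGreenBlockDivergenceFamilyAllMembers
import HarnessLib

/-!
# Route `UnitScaleTilt`, crux K1 «MinimiserStabilityRegPr» (stmt-QuantumFields-19200), EX face, norm_G ∕ h133 road — **(D0) ROOM-FREE (R-S): THE SUP COVARIANT-DIVERGENCE ROW OF `G₀`
# ON SUP-BOUNDED SOURCES AT EVERY MEMBER** — today's ✓`Prop7OneFormGreenSupRowsOfBlockRows` §2∕§3 (`norm_symm_DstarL2_GT_le_of_sup`, `divergence_GT_DeltaEtaSlot_sup_kfree`, `exists_valueDiv_sup_kfree`)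
# and ✓`Prop7OneFormGreenSupRowsFamily` (`divergence_GT_DeltaEtaSlot_sup_family`, joint `valueDiv_GT_DeltaEtaSlot_sup_family`) with the no-wrap antecedent `hroom` ∕ the ROOM conjunct DELETED,
# re-run over R-D1∕R-D2 ✓`…OneFormGreenBlockDivergence{,Family}AllMembers` (⟸ px5 g15's R1 cover reading of T1-κ).  The (V0) halves carry no room and are IMPORTED unchanged.
# (width seat `ym3-torus-px21` g16; GENERATED by `gen/gen_rs.py`: rename `X ↦ X_allMembers`, delete the ONE binder∕conjunct (+ its `intro`), swap the ONE supplier token, drop the ONE `hroom`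
# argument — each edit asserted once; variable blocks VERBATIM.)

Cell `ym3-torus` (HUMAN RULING D-0037; rung R3 = SU(2) YM₃ on T³ — NOT d = 4, NOT infinite volume, NOT a mass gap, NOT Clay).  THEOREMS ONLY (0 `def`, 0 `sorry`, default heartbeats);
`--supports stmt-QuantumFields-19200 --as helper`; count-neutral.

WHAT IS PROVED (ns `Summit.QuantumFields.YangMills.Theorems.Prop7OneFormGreenSupRowsAllMembers`).
* ★★★ `norm_symm_DstarL2_GT_le_of_sup_allMembers` — (D0) at the member, (dκ) letters + `hvalb` + margin, NO ROOM.
* ★★★ `divergence_GT_DeltaEtaSlot_sup_kfree_allMembers` — (D0)-K: FILE C ∕ (O-G1)'s `hDiv` TEXT with the member-free `C_D⋆·(2(1+1∕κ₁))³` under `RegPr` + windows + `Lift` + coupling window + (γ) +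
  `hk_D` + budgets + margin, NO ROOM; ★★ `exists_valueDiv_sup_kfree_allMembers` — `∃ BV BD, 0 ≤ BV ∧ 0 ≤ BD ∧ hV ∧ hDiv` (FILE C :165–168 texts VERBATIM), NO ROOM.
* ★★★ `divergence_GT_DeltaEtaSlot_sup_family_allMembers` — (D0) for all members, L-only `∃ αG BD`, NO ROOM conjunct; ★★★ `valueDiv_GT_DeltaEtaSlot_sup_family_allMembers` — the JOINT package
  `∃ αG BV BD` at one cap with BOTH FILE C ∕ (O-G1) texts per member under `RegPr ∧ cap ∧ Lift ∧ coupling window` ONLY.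
NET.  FILE C ∕ (O-G1) ∕ (∇π)-KNIT's four slots `hBV hBD hV hDiv` are met at EVERY member `i : Idx L` with no T1 room displayed anywhere in the chain.
HYP-SAT (★★OWNER RULING №42): the tree's hypotheses minus the room.  HONEST SCOPE: mechanical re-runs; CONDITIONAL on the displayed letters; nothing of FILE C, (O-G1), `norm_G`, `h133`,
the EX rows, EX, 19200 or the rung is proved; no summit is proved by a helper; the Yang–Mills mass gap is NOT proved.

References: T. Bałaban, CMP **99** (1985) 389–434 [Balaban1985BackgroundPropagators] (Thm 3.1 (3.42)–(3.44) p.397, Thm 3.3 (3.47)–(3.49) pp.398–399, Thm 3.11 p.416, Thm 3.12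
p.422–423); CMP **102** (1985) 277–309 [Balaban1985Variational] (Thm 1 p.279, (19) p.281, (134)–(135) p.298).
-/

set_option autoImplicit false

noncomputable section

open scoped Matrix.Norms.L2Operator BigOperators InnerProductSpace ComplexConjugate

namespace Summit.QuantumFields.YangMills.Theorems.Prop7OneFormGreenSupRowsAllMembers

open Literature.MathematicalPhysics.QuantumFieldTheory.Balaban1983to89
open Literature.MathematicalPhysics.QuantumFieldTheory.Balaban1983to89.T3ContinuumYM3Torus
open Literature.MathematicalPhysics.QuantumFieldTheory.Balaban1983to89.T3PrintedRegularMinimiser (RegPr)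
open B15DeterminingSets (embIter)
open T3SectALandauChart (formComp bgUnits eta eta_pos)
open B9SectCLatticeCarrier (Bond)
open B9Eq311L2Pairing (WL2)
open B11Eq103H1Complex (BondL2K SiteL2K)
open B5Eq118OneStroke (iterBlockOf)
open Summit.QuantumFields.YangMills.Theorems.Prop8Chart (emlIterU)
open Summit.QuantumFields.YangMills.Theorems.Prop7SectET3Transport (periodsT3 bondEquiv)
open Summit.QuantumFields.YangMills.Theorems.Prop7SectET3HilbertLetters (W₂ toL2 toL2S DL2 DstarL2)
open Summit.QuantumFields.YangMills.Theorems.Prop7SectET3WilsonHessian (DeltaEtaSlot)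
open Summit.QuantumFields.YangMills.Theorems.Prop7SectET3GaugeProjector (RS)
open Summit.QuantumFields.YangMills.Theorems.Prop7SectET3CurvedPropagators (laplaceA Qk GT PosOnto)
open Summit.QuantumFields.YangMills.Theorems.Prop7CurvedMemberLocalGradient (exists_curved_localGradient)
open Summit.QuantumFields.YangMills.Theorems.AxialGaugeChartGlue (norm_bgOfCfg_axialT_sub_le)
open Summit.QuantumFields.YangMills.Theorems.Prop7GreenPiBlockLettersEdition (weighted_of_blockSupported)
open Summit.QuantumFields.YangMills.Theorems.Prop7OneFormGreenBlockDivergenceAllMembers (norm_symm_DstarL2_GT_le_of_blockSupport_allMembers divergence_GT_DeltaEtaSlot_kfree_allMembers)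
open Summit.QuantumFields.YangMills.Theorems.Prop7OneFormGreenBlockSupKFree (blockSup_GT_DeltaEtaSlot_kfree)
open Summit.QuantumFields.YangMills.Theorems.Prop7OneFormGreenSupRowsOfBlockRows (sup_of_blockSupported valueReader_blockAdditive divReader_blockAdditive value_GT_DeltaEtaSlot_sup_kfree)
open Summit.QuantumFields.YangMills.Theorems.Prop7OneFormGreenBlockDivergenceFamilyAllMembers (divergence_GT_DeltaEtaSlot_family_allMembers)
open Summit.QuantumFields.YangMills.Theorems.Prop7OneFormGreenBlockSupFamily (blockSup_GT_DeltaEtaSlot_family)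
open Summit.QuantumFields.YangMills.Theorems.Prop7OneFormGreenSupRowsFamily (value_GT_DeltaEtaSlot_sup_family)

/-! ## §1 (D0) at every member (no room) -/

section Member

variable (F : T3Family) {n K : ℕ} (c₀ : ℝ) [Fact (0 < c₀)] (U₀ : GaugeField (F.P K) 0 (Matrix.specialUnitaryGroup (Fin 2) ℂ))
  {h : n ≤ K} {cB a : ℝ} [Fact (0 < cB)]

/-- ★★★ **(D0), THE SUP COVARIANT-DIVERGENCE ROW OF `G₀` ON SUP-BOUNDED SOURCES, AT THE MEMBER** — at the (dκ) letters of ✓`norm_symm_DstarL2_GT_le_of_blockSupport` with the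
decayed VALUE row quantified over block-supported sources (`hvalb` = px16 ✓`Prop7OneFormGreenSupBound.norm_symm_GT_apply_le_of_blockSupport`'s conclusion, binders
`X z hXz s hs hX bd`) + the gradient margin (NO no-wrap room — R-D1 over px5 R1) (F1 ✓`norm_nabla115_GT_le_of_sup`'s hypotheses token for token): for EVERY bond field `X` with `‖X b‖ ≤ s`,
`‖toL2S⁻¹(D*_{U₀}(G₀(toL2 X))) x‖ ≤ (C_D·(2(1+1∕κ₁))³)·s` — FILE C ∕ (O-G1)'s `hDiv` binder TEXT with `BD := C_D·(2(1+1∕κ₁))³`, `κ₁ = min r ¼ ∕ 2`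
([Balaban1985BackgroundPropagators] Thm 3.3 (3.47)₃ `|G∇*f|`-class ∕ Thm 3.1 (3.42) `|∇G|, |G∇*| ≤ B` for the member's `G₀`, sup currency; here the covariant divergence OF `G₀f`).
PROOF: §1 `sup_of_blockSupported` for the divergence reader with the block letter (dκ) (fed `hval := hvalb X z hXz s hs hX`).
[cite: Balaban1985BackgroundPropagators, Thm 3.1 (3.42)–(3.44) p.397, Thm 3.3 (3.47)–(3.49) pp.398–399, Thm 3.12 p.422; Balaban1985Variational, (19) p.281, (134)–(135) p.298] -/
theorem norm_symm_DstarL2_GT_le_of_sup_allMembers (hnK : n ≤ K) {ε₀ : ℝ} (hε₀ : 0 < ε₀) (hε₀1 : ε₀ ≤ 1) (hreg : RegPr F n K ε₀ U₀)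
    (hp : PosOnto F n K h c₀ cB a (DeltaEtaSlot F n K c₀) U₀)
    {r : ℝ} (hr : 0 < r) {γ CV θV ε : ℝ} (hε : 0 < ε) (hε1 : ε ≤ 1)
    (hco : ∀ v : BondL2K ℂ 3 (periodsT3 F K) c₀ W₂, γ * ‖v‖ ^ 2 ≤ RCLike.re ⟪v, laplaceA F n K h c₀ cB a (DeltaEtaSlot F n K c₀) U₀ v⟫_ℂ)
    (hVlow : ∀ X : PBond (F.P K) 0 → Matrix (Fin 2) (Fin 2) ℂ,
      -(CV * ‖toL2 F K c₀ X‖ ^ 2) ≤ RCLike.re ⟪toL2 F K c₀ X, laplaceA F n K h c₀ cB a (DeltaEtaSlot F n K c₀) U₀ (toL2 F K c₀ X)⟫_ℂ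
        - ∑ μ : Fin (F.P K).d, ‖DL2 F n K c₀ U₀ (toL2S F K c₀ (formComp X μ))‖ ^ 2)
    (hVconj : ∀ φ : Site (F.P K) 0 → ℝ, (∀ x x' : Site (F.P K) 0, |φ x - φ x'| ≤ r * eta F n K * (Site.tdist x x' : ℝ)) →
      ∀ X : PBond (F.P K) 0 → Matrix (Fin 2) (Fin 2) ℂ,
      RCLike.re ⟪toL2 F K c₀ X, laplaceA F n K h c₀ cB a (DeltaEtaSlot F n K c₀) U₀ (toL2 F K c₀ X)⟫_ℂ
          - (∑ μ : Fin (F.P K).d, ‖DL2 F n K c₀ U₀ (toL2S F K c₀ (formComp X μ))‖ ^ 2) - θV * ‖toL2 F K c₀ X‖ ^ 2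
        ≤ RCLike.re ⟪toL2 F K c₀ (fun b => Real.exp (φ b.src) • X b), laplaceA F n K h c₀ cB a (DeltaEtaSlot F n K c₀) U₀ (toL2 F K c₀ (fun b => (Real.exp (φ b.src))⁻¹ • X b))⟫_ℂ
          - RCLike.re (∑ μ : Fin (F.P K).d, ⟪DL2 F n K c₀ U₀ (toL2S F K c₀ (formComp (fun b => Real.exp (φ b.src) • X b) μ)),
              DL2 F n K c₀ U₀ (toL2S F K c₀ (formComp (fun b => (Real.exp (φ b.src))⁻¹ • X b) μ))⟫_ℂ))
    (hΘ : 0 < ((1 - ε) * γ - ε * CV - 3 * (r ^ 2 * Real.exp (2 * r)) * (1 + 1 / ε) - θV))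
    {CkD CkQ μ' : ℝ} (hCkD : 0 ≤ CkD) (hCkQ : 0 ≤ CkQ) (hrμ : r < μ')
    (hkD : ∀ (b : PBond (F.P K) 0) (Z : Matrix (Fin 2) (Fin 2) ℂ) (bd : PBond (F.P K) 0),
      ‖(toL2 F K c₀).symm (DL2 F n K c₀ U₀ (DstarL2 F n K c₀ U₀ (toL2 F K c₀ (Pi.single b Z))
          - RS F n K h c₀ cB U₀ (DstarL2 F n K c₀ U₀ (toL2 F K c₀ (Pi.single b Z))))) bd‖
        ≤ CkD * Real.exp (-(μ' * (Site.tdist (P := F.P K) (iterBlockOf (K - n) b.src) (iterBlockOf (K - n) bd.src) : ℝ))) * ‖Z‖)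
    (hkQ : ∀ (b : PBond (F.P K) 0) (Z : Matrix (Fin 2) (Fin 2) ℂ) (bd : PBond (F.P K) 0),
      ‖(toL2 F K c₀).symm (LinearMap.adjoint (Qk F n K h c₀ cB U₀) (((a : ℝ) : ℂ) • Qk F n K h c₀ cB U₀ (toL2 F K c₀ (Pi.single b Z)))) bd‖
        ≤ CkQ * Real.exp (-(μ' * (Site.tdist (P := F.P K) (iterBlockOf (K - n) b.src) (iterBlockOf (K - n) bd.src) : ℝ))) * ‖Z‖)
    {AV : ℝ}
    (hvalb : ∀ (X : PBond (F.P K) 0 → Matrix (Fin 2) (Fin 2) ℂ) (z : Site (F.P K) (K - n)), (∀ b, X b ≠ 0 → iterBlockOf (K - n) b.src = z) →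
      ∀ s : ℝ, 0 ≤ s → (∀ b, ‖X b‖ ≤ s) →
      ∀ bd : PBond (F.P K) 0, ‖((toL2 F K c₀).symm (GT F n K h c₀ cB a (DeltaEtaSlot F n K c₀) U₀ (toL2 F K c₀ X))) bd‖ ≤ s * AV * Real.exp (-((min r (1 / 4) / 2) * (Site.tdist (P := F.P K) (iterBlockOf (K - n) bd.src) z : ℝ))))
    (hsmall : exists_curved_localGradient.choose * ((48 * ε₀) * (6 * Real.sqrt 2 * Real.sqrt 10 + 6 * Real.sqrt 2)) * Real.exp (51 * (min r (1 / 4) / 2)) ≤ 1 / 2)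
    :
    ∀ (X : PBond (F.P K) 0 → Matrix (Fin 2) (Fin 2) ℂ) (s : ℝ), (∀ b, ‖X b‖ ≤ s) →
      ∀ x : Site (F.P K) 0, ‖(toL2S F K c₀).symm (DstarL2 F n K c₀ U₀ (GT F n K h c₀ cB a (DeltaEtaSlot F n K c₀) U₀ (toL2 F K c₀ X))) x‖
        ≤ ((3 * (Real.exp (4 * (min r (1 / 4) / 2)) * (2 * ((exists_curved_localGradient.choose * (((Real.sqrt 2 * AV) * Real.exp (51 * (min r (1 / 4) / 2))) * (2 + 2 * Real.sqrt 2 * (4 * ε₀ * (3 + 2457 * norm_bgOfCfg_axialT_sub_le.choose)) + (24 * Real.sqrt 10 + 48) * (48 * ε₀) ^ 2) + (Real.sqrt 2 * ((32 * ε₀ * (AV * Real.exp (5 * (min r (1 / 4) / 2)))) + (CkD * Real.sqrt ((((F.P K).d : ℝ) * ((((F.P K).L : ℝ) ^ (F.P K).d) ^ (K - n))) / c₀) * (Real.exp (6 * r) * Real.sqrt (2 * c₀ * (((F.P K).d : ℝ) * ((((F.P K).L : ℝ) ^ (F.P K).d) ^ (K - n)))) / ((1 - ε) * γ - ε * CV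 - 3 * (r ^ 2 * Real.exp (2 * r)) * (1 + 1 / ε) - θV)) * (2 * (1 + 1 / (μ' - r))) ^ 3) + (CkQ * Real.sqrt ((((F.P K).d : ℝ) * ((((F.P K).L : ℝ) ^ (F.P K).d) ^ (K - n))) / c₀) * (Real.exp (6 * r) * Real.sqrt (2 * c₀ * (((F.P K).d : ℝ) * ((((F.P K).L : ℝ) ^ (F.P K).d) ^ (K - n)))) / ((1 - ε) * γ - ε * CV - 3 * (r ^ 2 * Real.exp (2 * r)) * (1 + 1 / ε) - θV)) * (2 * (1 + 1 / (μ' - r))) ^ 3) + 1)) * Real.exp (51 * (min r (1 / 4) / 2))) + 2 * Real.sqrt 2 * (48 * ε₀) * ((Real.sqrt 2 * AV) * Real.exp (51 * (min r (1 / 4) / 2)))))))) * (2 * (1 + 1 / (min r (1 / 4) / 2))) ^ 3) * s := by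
  intro X s hX x
  have hk1 : 0 < (min r (1 / 4) / 2) := by have := lt_min hr (by norm_num : (0 : ℝ) < 1 / 4); positivity
  haveI : Nonempty (PBond (F.P K) 0) := ⟨⟨x, ⟨0, by rw [T3Family.P_d]; norm_num⟩⟩⟩
  exact sup_of_blockSupported (fun b : PBond (F.P K) 0 => iterBlockOf (K - n) b.src) (fun x' : Site (F.P K) 0 => iterBlockOf (K - n) x')
    (fun (Y : PBond (F.P K) 0 → Matrix (Fin 2) (Fin 2) ℂ) (x' : Site (F.P K) 0) =>
      (toL2S F K c₀).symm (DstarL2 F n K c₀ U₀ (GT F n K h c₀ cB a (DeltaEtaSlot F n K c₀) U₀ (toL2 F K c₀ Y))) x')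
    (divReader_blockAdditive F h c₀ cB a U₀) hk1
    (fun Y z hYz t ht hY x' => norm_symm_DstarL2_GT_le_of_blockSupport_allMembers F c₀ U₀ (h := h) (cB := cB) (a := a) hnK hε₀ hε₀1 hreg hp hr hε hε1 hco hVlow hVconj hΘ
      hCkD hCkQ hrμ hkD hkQ Y z hYz ht hY (hvalb Y z hYz t ht hY) hsmall x')
    X s hX x

end Member

/-! ## §2 (D0)-K at every member (no room), and the `∃`-pair with signs -/

section KFree

variable (F : T3Family) {n K : ℕ} (h : n ≤ K) (c₀ cB : ℝ) [Fact (0 < c₀)] [Fact (0 < cB)]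

/-- ★★★ **(D0)-K: THE SUP COVARIANT-DIVERGENCE ROW OF `G₀` ON SUP-BOUNDED SOURCES, UNDER `Lift`, MEMBER-FREE CONSTANT** — hypotheses = ✓`divergence_GT_DeltaEtaSlot_kfree`'s VERBATIM
((V0)-K's + the K-free gradient margin, NO no-wrap room `C_g·(48ε₀(6√2√10 + 6√2))·e^{51∕8} ≤ ½`); conclusion = FILE C ∕ (O-G1)'s `hDiv` binder TEXT
`∀ X s, (∀ b, ‖X b‖ ≤ s) → ∀ x, ‖toL2S⁻¹(D*_{U₀}(G₀(toL2 X))) x‖ ≤ BD·s` with `BD := C_D⋆·(2(1+1∕κ₁))³`, `C_D⋆` member-free (printed), `κ₁ = min r ¼ ∕ 2`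
([Balaban1985BackgroundPropagators] Thm 3.1 (3.42) `|G∇*|, |∇G|`-class row for the member's `G₀`, sup currency).  PROOF: §1 for the divergence reader with the block letter (dκ)-K.
[cite: Balaban1985BackgroundPropagators, Thm 3.1 (3.42)–(3.47) pp.397–399, (3.49) p.399, Thm 3.11 p.416, Thm 3.12 p.422; Balaban1985Variational, (134)–(135) p.298] -/
theorem divergence_GT_DeltaEtaSlot_sup_kfree_allMembers (hnK : n < K) {ε₀ : ℝ} (hε₀ : 0 < ε₀) (hWε : 10 ^ 12 * (F.L : ℝ) ^ 3 * ε₀ ≤ 1)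
    (hε10 : 10 ^ 10 * (F.L : ℝ) ^ 6 * ε₀ ≤ 1) (hwin : 13 * 10 ^ 14 * (F.L : ℝ) ^ 3 * ε₀ ≤ 1)
    (U₀ : GaugeField (F.P K) 0 (Matrix.specialUnitaryGroup (Fin 2) ℂ)) (hreg : RegPr F n K ε₀ U₀)
    (hlift : ∀ cf : Site (F.P K) (K - n) → Matrix (Fin 2) (Fin 2) ℂ,
        (∀ e : PBond (F.P K) (K - n), cf e.src = ((emlIterU (K - n) (bgUnits F K U₀) e : (Matrix (Fin 2) (Fin 2) ℂ)ˣ) : Matrix (Fin 2) (Fin 2) ℂ) * cf e.tgt *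
          (((emlIterU (K - n) (bgUnits F K U₀) e)⁻¹ : (Matrix (Fin 2) (Fin 2) ℂ)ˣ) : Matrix (Fin 2) (Fin 2) ℂ)) →
        ∃ l₀ : Site (F.P K) 0 → Matrix (Fin 2) (Fin 2) ℂ,
          (∀ b : PBond (F.P K) 0, l₀ b.src = ((bgUnits F K U₀ b : (Matrix (Fin 2) (Fin 2) ℂ)ˣ) : Matrix (Fin 2) (Fin 2) ℂ) * l₀ b.tgt * (((bgUnits F K U₀ b)⁻¹ : (Matrix (Fin 2) (Fin 2) ℂ)ˣ) : Matrix (Fin 2) (Fin 2) ℂ)) ∧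
          ∀ y : Site (F.P K) (K - n), l₀ (embIter (K - n) y) = cf y)
    {a a₁ : ℝ} (ha : 0 ≤ a) (ha₁ : a ≤ a₁ * (c₀ / cB) * ((F.L : ℝ) ^ (K - n)) ^ 3)
    {γ : ℝ} (hγ : 0 < γ) (hco : ∀ v : BondL2K ℂ 3 (periodsT3 F K) c₀ W₂, γ * ‖v‖ ^ 2 ≤ RCLike.re ⟪v, laplaceA F n K h c₀ cB a (DeltaEtaSlot F n K c₀) U₀ v⟫_ℂ)
    {CK δK : ℝ} (hCK : 0 ≤ CK) (hδK : 0 < δK)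
    (hkD : ∀ (b : PBond (F.P K) 0) (Z : Matrix (Fin 2) (Fin 2) ℂ) (bd : PBond (F.P K) 0),
      ‖(toL2 F K c₀).symm (DL2 F n K c₀ U₀ (DstarL2 F n K c₀ U₀ (toL2 F K c₀ (Pi.single b Z))
          - RS F n K h c₀ cB U₀ (DstarL2 F n K c₀ U₀ (toL2 F K c₀ (Pi.single b Z))))) bd‖
        ≤ CK * ((F.L : ℝ) ^ (K - n))⁻¹ ^ 3 * Real.exp (-(δK * (Site.tdist (P := F.P K) (iterBlockOf (K - n) b.src) (iterBlockOf (K - n) bd.src) : ℝ))) * ‖Z‖)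
    {r ε : ℝ} (hr : 0 < r) (hr4 : r ≤ 1 / 4) (hrδ : r ≤ δK / 2) (hε : 0 < ε) (hε8 : ε ≤ 1 / 8)
    (hεC : ε * (32 * Real.sqrt 2 * 648 + (33 / 8 : ℝ) ^ 2 * (600 * (27 / 4 : ℝ) ^ 6)) ≤ γ / 8) (hrγ : r ≤ γ * ε / 48)
    (hrT : r * (5000 * a₁ + 27 * Real.sqrt 2 * CK * (2 * (1 + 4 / δK)) ^ 3 / min 1 (δK / 4)) ≤ γ / 16) (hαγ : 10 ^ 5 * ε₀ ≤ γ / 16)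
    (hsmall : exists_curved_localGradient.choose * ((48 * ε₀) * (6 * Real.sqrt 2 * Real.sqrt 10 + 6 * Real.sqrt 2)) * Real.exp (51 / 8) ≤ 1 / 2) :
    ∀ (X : PBond (F.P K) 0 → Matrix (Fin 2) (Fin 2) ℂ) (s : ℝ), (∀ b, ‖X b‖ ≤ s) →
      ∀ x : Site (F.P K) 0, ‖(toL2S F K c₀).symm (DstarL2 F n K c₀ U₀ (GT F n K h c₀ cB a (DeltaEtaSlot F n K c₀) U₀ (toL2 F K c₀ X))) x‖
        ≤ ((3 * (Real.exp (4 / 8) * (2 * ((exists_curved_localGradient.choose * (((Real.sqrt 2 * (2 * ((Real.sqrt 2 + Real.sqrt 2 * ((50 * a₁ * Real.exp δK + CK) * (3 * Real.sqrt 2) * (Real.exp (6 * r) * (2 / γ)) * (2 * (1 + 2 / δK)) ^ 3)) * (8 * Real.exp (3 * r)) * 14 + 36 * (Real.sqrt (8 * Real.exp (3 * r) * (2 * (1 + 1 / r)) ^ 3) * (Real.exp (6 * r) * (2 / γ)))))) * Real.exp (51 / 8)) * (2 + 2 * Real.sqrt 2 * (4 * ε₀ * (3 + 2457 * norm_bgOfCfg_axialT_sub_le.choose))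 + (24 * Real.sqrt 10 + 48) * (48 * ε₀) ^ 2) + (Real.sqrt 2 * ((32 * ε₀ * ((2 * ((Real.sqrt 2 + Real.sqrt 2 * ((50 * a₁ * Real.exp δK + CK) * (3 * Real.sqrt 2) * (Real.exp (6 * r) * (2 / γ)) * (2 * (1 + 2 / δK)) ^ 3)) * (8 * Real.exp (3 * r)) * 14 + 36 * (Real.sqrt (8 * Real.exp (3 * r) * (2 * (1 + 1 / r)) ^ 3) * (Real.exp (6 * r) * (2 / γ))))) * Real.exp (5 / 8))) + (CK * (3 * Real.sqrt 2) * (Real.exp (6 * r) * (2 / γ)) * (2 * (1 + 2 / δK)) ^ 3) + ((50 * a₁ * Real.exp δK) * (3 * Real.sqrt 2) * (Real.exp (6 * r) * (2 / γ)) * (2 * (1 + 2 / δK)) ^ 3) + 1)) * Real.exp (51 / 8)) + 2 * Real.sqrt 2 * (48 * ε₀) * ((Real.sqrt 2 * (2 * ((Real.sqrt 2 + Real.sqrt 2 * ((50 * a₁ * Real.exp δK + CK) * (3 * Real.sqrt 2) * (Real.exp (6 * r) * (2 / γ)) * (2 * (1 + 2 / δK)) ^ 3)) * (8 * Real.exp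 (3 * r)) * 14 + 36 * (Real.sqrt (8 * Real.exp (3 * r) * (2 * (1 + 1 / r)) ^ 3) * (Real.exp (6 * r) * (2 / γ)))))) * Real.exp (51 / 8))))))) * (2 * (1 + 1 / (min r (1 / 4) / 2))) ^ 3) * s := by
  intro X s hX x
  have hk1 : 0 < (min r (1 / 4) / 2) := by have := lt_min hr (by norm_num : (0 : ℝ) < 1 / 4); positivity
  haveI : Nonempty (PBond (F.P K) 0) := ⟨⟨x, ⟨0, by rw [T3Family.P_d]; norm_num⟩⟩⟩
  exact sup_of_blockSupported (fun b : PBond (F.P K) 0 => iterBlockOf (K - n) b.src) (fun x' : Site (F.P K) 0 => iterBlockOf (K - n) x')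
    (fun (Y : PBond (F.P K) 0 → Matrix (Fin 2) (Fin 2) ℂ) (x' : Site (F.P K) 0) =>
      (toL2S F K c₀).symm (DstarL2 F n K c₀ U₀ (GT F n K h c₀ cB a (DeltaEtaSlot F n K c₀) U₀ (toL2 F K c₀ Y))) x')
    (divReader_blockAdditive F h c₀ cB a U₀) hk1
    (divergence_GT_DeltaEtaSlot_kfree_allMembers F h c₀ cB hnK hε₀ hWε hε10 hwin U₀ hreg hlift ha ha₁ hγ hco hCK hδK hkD hr hr4 hrδ hε hε8 hεC hrγ hrT hαγ hsmall)
    X s hX x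

/-- ★★ **(V0)+(D0)-K AS ONE `∃`-PAIR WITH SIGNS — FILE C ∕ (O-G1)'s `hBV hBD hV hDiv` SLOTS, TEXTS VERBATIM** (inner binders `∀ b` ∕ `∀ x` as FILE C prints them): under the
(D0)-K hypotheses WITHOUT the room, `∃ BV BD : ℝ, 0 ≤ BV ∧ 0 ≤ BD ∧ hV-text ∧ hDiv-text`.  The signs are read off the rows at the zero source; the witnesses are §3's printed constants.  This is the
dockable edition for an `∃`-assembly (`obtain ⟨BV, BD, hBV, hBD, hV, hDiv⟩ := …` then FILE C ∕ (O-G1) by name). [cite: Balaban1985BackgroundPropagators, Thm 3.3 (3.47) p.398, Thm 3.12 p.422–423] -/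
theorem exists_valueDiv_sup_kfree_allMembers (hnK : n < K) {ε₀ : ℝ} (hε₀ : 0 < ε₀) (hWε : 10 ^ 12 * (F.L : ℝ) ^ 3 * ε₀ ≤ 1)
    (hε10 : 10 ^ 10 * (F.L : ℝ) ^ 6 * ε₀ ≤ 1) (hwin : 13 * 10 ^ 14 * (F.L : ℝ) ^ 3 * ε₀ ≤ 1)
    (U₀ : GaugeField (F.P K) 0 (Matrix.specialUnitaryGroup (Fin 2) ℂ)) (hreg : RegPr F n K ε₀ U₀)
    (hlift : ∀ cf : Site (F.P K) (K - n) → Matrix (Fin 2) (Fin 2) ℂ,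
        (∀ e : PBond (F.P K) (K - n), cf e.src = ((emlIterU (K - n) (bgUnits F K U₀) e : (Matrix (Fin 2) (Fin 2) ℂ)ˣ) : Matrix (Fin 2) (Fin 2) ℂ) * cf e.tgt *
          (((emlIterU (K - n) (bgUnits F K U₀) e)⁻¹ : (Matrix (Fin 2) (Fin 2) ℂ)ˣ) : Matrix (Fin 2) (Fin 2) ℂ)) →
        ∃ l₀ : Site (F.P K) 0 → Matrix (Fin 2) (Fin 2) ℂ,
          (∀ b : PBond (F.P K) 0, l₀ b.src = ((bgUnits F K U₀ b : (Matrix (Fin 2) (Fin 2) ℂ)ˣ) : Matrix (Fin 2) (Fin 2) ℂ) * l₀ b.tgt * (((bgUnits F K U₀ b)⁻¹ : (Matrix (Fin 2) (Fin 2) ℂ)ˣ) : Matrix (Fin 2) (Fin 2) ℂ)) ∧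
          ∀ y : Site (F.P K) (K - n), l₀ (embIter (K - n) y) = cf y)
    {a a₁ : ℝ} (ha : 0 ≤ a) (ha₁ : a ≤ a₁ * (c₀ / cB) * ((F.L : ℝ) ^ (K - n)) ^ 3)
    {γ : ℝ} (hγ : 0 < γ) (hco : ∀ v : BondL2K ℂ 3 (periodsT3 F K) c₀ W₂, γ * ‖v‖ ^ 2 ≤ RCLike.re ⟪v, laplaceA F n K h c₀ cB a (DeltaEtaSlot F n K c₀) U₀ v⟫_ℂ)
    {CK δK : ℝ} (hCK : 0 ≤ CK) (hδK : 0 < δK)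
    (hkD : ∀ (b : PBond (F.P K) 0) (Z : Matrix (Fin 2) (Fin 2) ℂ) (bd : PBond (F.P K) 0),
      ‖(toL2 F K c₀).symm (DL2 F n K c₀ U₀ (DstarL2 F n K c₀ U₀ (toL2 F K c₀ (Pi.single b Z))
          - RS F n K h c₀ cB U₀ (DstarL2 F n K c₀ U₀ (toL2 F K c₀ (Pi.single b Z))))) bd‖
        ≤ CK * ((F.L : ℝ) ^ (K - n))⁻¹ ^ 3 * Real.exp (-(δK * (Site.tdist (P := F.P K) (iterBlockOf (K - n) b.src) (iterBlockOf (K - n) bd.src) : ℝ))) * ‖Z‖)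
    {r ε : ℝ} (hr : 0 < r) (hr4 : r ≤ 1 / 4) (hrδ : r ≤ δK / 2) (hε : 0 < ε) (hε8 : ε ≤ 1 / 8)
    (hεC : ε * (32 * Real.sqrt 2 * 648 + (33 / 8 : ℝ) ^ 2 * (600 * (27 / 4 : ℝ) ^ 6)) ≤ γ / 8) (hrγ : r ≤ γ * ε / 48)
    (hrT : r * (5000 * a₁ + 27 * Real.sqrt 2 * CK * (2 * (1 + 4 / δK)) ^ 3 / min 1 (δK / 4)) ≤ γ / 16) (hαγ : 10 ^ 5 * ε₀ ≤ γ / 16)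
    (hsmall : exists_curved_localGradient.choose * ((48 * ε₀) * (6 * Real.sqrt 2 * Real.sqrt 10 + 6 * Real.sqrt 2)) * Real.exp (51 / 8) ≤ 1 / 2) :
    ∃ BV BD : ℝ, 0 ≤ BV ∧ 0 ≤ BD ∧
      (∀ (X : PBond (F.P K) 0 → Matrix (Fin 2) (Fin 2) ℂ) (s : ℝ), (∀ b, ‖X b‖ ≤ s) →
        ∀ b, ‖(toL2 F K c₀).symm (GT F n K h c₀ cB a (DeltaEtaSlot F n K c₀) U₀ (toL2 F K c₀ X)) b‖ ≤ BV * s) ∧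
      (∀ (X : PBond (F.P K) 0 → Matrix (Fin 2) (Fin 2) ℂ) (s : ℝ), (∀ b, ‖X b‖ ≤ s) →
        ∀ x, ‖(toL2S F K c₀).symm (DstarL2 F n K c₀ U₀ (GT F n K h c₀ cB a (DeltaEtaSlot F n K c₀) U₀ (toL2 F K c₀ X))) x‖ ≤ BD * s) := by
  have hV := value_GT_DeltaEtaSlot_sup_kfree F h c₀ cB hnK hε₀ hWε hε10 hwin U₀ hreg hlift ha ha₁ hγ hco hCK hδK hkD hr hr4 hrδ hε hε8 hεC hrγ hrT hαγ
  have hD := divergence_GT_DeltaEtaSlot_sup_kfree_allMembers F h c₀ cB hnK hε₀ hWε hε10 hwin U₀ hreg hlift ha ha₁ hγ hco hCK hδK hkD hr hr4 hrδ hε hε8 hεC hrγ hrT hαγ hsmall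
  -- signs off the rows at the ZERO source (`s := 1`)
  obtain ⟨x₀⟩ : Nonempty (Site (F.P K) 0) := inferInstance
  have b₀ : PBond (F.P K) 0 := ⟨x₀, ⟨0, by rw [T3Family.P_d]; norm_num⟩⟩
  have h1 : ∀ b : PBond (F.P K) 0, ‖(fun _ : PBond (F.P K) 0 => (0 : Matrix (Fin 2) (Fin 2) ℂ)) b‖ ≤ 1 := fun _ => by rw [norm_zero]; exact zero_le_one
  refine ⟨_, _, ?_, ?_, hV, hD⟩
  · have h0 := hV (fun _ => 0) 1 h1 b₀
    rw [mul_one] at h0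
    exact (norm_nonneg _).trans h0
  · have h0 := hD (fun _ => 0) 1 h1 x₀
    rw [mul_one] at h0
    exact (norm_nonneg _).trans h0

end KFree

/-! ## §3 (D0) for all members and the joint package, L-only constants (no room) -/

/-- ★★★ **(D0) FOR ALL MEMBERS WITH ROOM, L-ONLY CONSTANTS** — FILE C ∕ (O-G1)'s `hDiv` letter (the sup covariant-divergence row of `G₀` on sup-bounded sources) for every `L > 1`, every
member `i : Idx L`, every printed-regular background below the cap, under `Lift`, in the coupling window (NO no-wrap room — R-D2 over px5 R1): `∃ αG BD : ℕ → ℝ` with the three windows of record and `0 ≤ BD L`; binder texts = ✓`divergence_GT_DeltaEtaSlot_family`'s, conclusion the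
SUP text (`BD L := CD L·(2(1+1∕δG L))³`).  PROOF: that family's package and §1 per member.
[cite: Balaban1985BackgroundPropagators, Thm 3.1 (3.42)–(3.44) p.397, Thm 3.3 (3.47)–(3.49) pp.398–399, Thm 3.12 p.422; Balaban1985Variational, Thm 1 p.279, (134)–(135) p.298] -/
theorem divergence_GT_DeltaEtaSlot_sup_family_allMembers (c₀ cB : ℕ → ℝ) [hc₀ : ∀ L : ℕ, Fact (0 < c₀ L)] [hcB : ∀ L : ℕ, Fact (0 < cB L)] {a₀ a₁ : ℝ} (ha₀ : 0 < a₀) (ha₀₁ : a₀ ≤ a₁) :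
    ∃ (αG BD : ℕ → ℝ),
      (∀ L : ℕ, 1 < L → 0 < αG L) ∧ (∀ L : ℕ, 1 < L → 10 ^ 12 * (L : ℝ) ^ 3 * αG L ≤ 1) ∧ (∀ L : ℕ, 1 < L → 10 ^ 10 * (L : ℝ) ^ 6 * αG L ≤ 1) ∧
      (∀ L : ℕ, 1 < L → 13 * 10 ^ 14 * (L : ℝ) ^ 3 * αG L ≤ 1) ∧ (∀ L : ℕ, 1 < L → 0 ≤ BD L) ∧
    ∀ (L : ℕ), 1 < L → ∀ (i : T3Thm1Carrier.Idx L) (U₀ : GaugeField (i.1.1.P i.1.2.2) 0 (Matrix.specialUnitaryGroup (Fin 2) ℂ)), ∀ ρ : ℝ, RegPr i.1.1 i.1.2.1 i.1.2.2 ρ U₀ → ρ ≤ αG L →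
        (∀ cf : Site (i.1.1.P i.1.2.2) (i.1.2.2 - i.1.2.1) → Matrix (Fin 2) (Fin 2) ℂ,
        (∀ e' : PBond (i.1.1.P i.1.2.2) (i.1.2.2 - i.1.2.1), cf e'.src = ((emlIterU (i.1.2.2 - i.1.2.1) (bgUnits i.1.1 i.1.2.2 U₀) e' : (Matrix (Fin 2) (Fin 2) ℂ)ˣ) : Matrix (Fin 2) (Fin 2) ℂ) * cf e'.tgt *
        (((emlIterU (i.1.2.2 - i.1.2.1) (bgUnits i.1.1 i.1.2.2 U₀) e')⁻¹ : (Matrix (Fin 2) (Fin 2) ℂ)ˣ) : Matrix (Fin 2) (Fin 2) ℂ)) →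
        ∃ l₀ : Site (i.1.1.P i.1.2.2) 0 → Matrix (Fin 2) (Fin 2) ℂ,
        (∀ b' : PBond (i.1.1.P i.1.2.2) 0, l₀ b'.src = ((bgUnits i.1.1 i.1.2.2 U₀ b' : (Matrix (Fin 2) (Fin 2) ℂ)ˣ) : Matrix (Fin 2) (Fin 2) ℂ) * l₀ b'.tgt * (((bgUnits i.1.1 i.1.2.2 U₀ b')⁻¹ : (Matrix (Fin 2) (Fin 2) ℂ)ˣ) : Matrix (Fin 2) (Fin 2) ℂ)) ∧
        ∀ y : Site (i.1.1.P i.1.2.2) (i.1.2.2 - i.1.2.1), l₀ (embIter (i.1.2.2 - i.1.2.1) y) = cf y) →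
      ∀ a : ℝ, a₀ * (c₀ L / cB L) * ((i.1.1.L : ℝ) ^ (i.1.2.2 - i.1.2.1)) ^ 3 ≤ a → a ≤ a₁ * (c₀ L / cB L) * ((i.1.1.L : ℝ) ^ (i.1.2.2 - i.1.2.1)) ^ 3 →
      ∀ (X : PBond (i.1.1.P i.1.2.2) 0 → Matrix (Fin 2) (Fin 2) ℂ) (s : ℝ), (∀ b, ‖X b‖ ≤ s) →
        ∀ x : Site (i.1.1.P i.1.2.2) 0,
          ‖(toL2S i.1.1 i.1.2.2 (c₀ L)).symm (DstarL2 i.1.1 i.1.2.1 i.1.2.2 (c₀ L) U₀ (GT i.1.1 i.1.2.1 i.1.2.2 i.2.2.le (c₀ L) (cB L) a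
              (DeltaEtaSlot i.1.1 i.1.2.1 i.1.2.2 (c₀ L)) U₀ (toL2 i.1.1 i.1.2.2 (c₀ L) X))) x‖
            ≤ BD L * s := by
  obtain ⟨αG, CD, δG, hα, hW1, hW2, hW3, hCD, hδG, hmem⟩ := divergence_GT_DeltaEtaSlot_family_allMembers c₀ cB ha₀ ha₀₁
  refine ⟨αG, fun L => CD L * (2 * (1 + 1 / δG L)) ^ 3, hα, hW1, hW2, hW3, fun L hL => ?_, ?_⟩
  · have := hCD L hL
    have := hδG L hL
    positivity
  intro L hL i U₀ ρ hreg hρ hlift a ha₀a ha₁a X s hX x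
  haveI : Nonempty (PBond (i.1.1.P i.1.2.2) 0) := ⟨⟨x, ⟨0, by rw [T3Family.P_d]; norm_num⟩⟩⟩
  exact sup_of_blockSupported (fun b : PBond (i.1.1.P i.1.2.2) 0 => iterBlockOf (i.1.2.2 - i.1.2.1) b.src) (fun x' : Site (i.1.1.P i.1.2.2) 0 => iterBlockOf (i.1.2.2 - i.1.2.1) x')
    (fun (Y : PBond (i.1.1.P i.1.2.2) 0 → Matrix (Fin 2) (Fin 2) ℂ) (x' : Site (i.1.1.P i.1.2.2) 0) =>
      (toL2S i.1.1 i.1.2.2 (c₀ L)).symm (DstarL2 i.1.1 i.1.2.1 i.1.2.2 (c₀ L) U₀ (GT i.1.1 i.1.2.1 i.1.2.2 i.2.2.le (c₀ L) (cB L) a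
        (DeltaEtaSlot i.1.1 i.1.2.1 i.1.2.2 (c₀ L)) U₀ (toL2 i.1.1 i.1.2.2 (c₀ L) Y))) x')
    (divReader_blockAdditive i.1.1 i.2.2.le (c₀ L) (cB L) a U₀) (hδG L hL)
    (hmem L hL i U₀ ρ hreg hρ hlift a ha₀a ha₁a) X s hX x


/-- ★★★ **(V0)+(D0) FOR ALL MEMBERS WITH ROOM AT ONE CAP, L-ONLY CONSTANTS** — `∃ αG BV BD : ℕ → ℝ` (cap with the three windows of record, `0 ≤ BV L`, `0 ≤ BD L`) such that for
every `L > 1`, member `i : Idx L`, background `U₀` with `RegPr ρ U₀`, `ρ ≤ αG L`, under `Lift`, every coupling in the window (NO ROOM): BOTH FILE C ∕ (O-G1)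
letters, the `hV` TEXT `… ≤ BV L * s` AND the `hDiv` TEXT `… ≤ BD L * s` (cap `αG := min` of §1's two caps).  [cite: Balaban1985BackgroundPropagators, Thm 3.1 (3.42) p.397,
Thm 3.3 (3.47)–(3.49) pp.398–399, Thm 3.12 p.422–423; Balaban1985Variational, Thm 1 p.279] -/
theorem valueDiv_GT_DeltaEtaSlot_sup_family_allMembers (c₀ cB : ℕ → ℝ) [hc₀ : ∀ L : ℕ, Fact (0 < c₀ L)] [hcB : ∀ L : ℕ, Fact (0 < cB L)] {a₀ a₁ : ℝ} (ha₀ : 0 < a₀) (ha₀₁ : a₀ ≤ a₁) :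
    ∃ (αG BV BD : ℕ → ℝ),
      (∀ L : ℕ, 1 < L → 0 < αG L) ∧ (∀ L : ℕ, 1 < L → 10 ^ 12 * (L : ℝ) ^ 3 * αG L ≤ 1) ∧ (∀ L : ℕ, 1 < L → 10 ^ 10 * (L : ℝ) ^ 6 * αG L ≤ 1) ∧
      (∀ L : ℕ, 1 < L → 13 * 10 ^ 14 * (L : ℝ) ^ 3 * αG L ≤ 1) ∧ (∀ L : ℕ, 1 < L → 0 ≤ BV L) ∧ (∀ L : ℕ, 1 < L → 0 ≤ BD L) ∧
    ∀ (L : ℕ), 1 < L → ∀ (i : T3Thm1Carrier.Idx L) (U₀ : GaugeField (i.1.1.P i.1.2.2) 0 (Matrix.specialUnitaryGroup (Fin 2) ℂ)), ∀ ρ : ℝ, RegPr i.1.1 i.1.2.1 i.1.2.2 ρ U₀ → ρ ≤ αG L →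
        (∀ cf : Site (i.1.1.P i.1.2.2) (i.1.2.2 - i.1.2.1) → Matrix (Fin 2) (Fin 2) ℂ,
        (∀ e' : PBond (i.1.1.P i.1.2.2) (i.1.2.2 - i.1.2.1), cf e'.src = ((emlIterU (i.1.2.2 - i.1.2.1) (bgUnits i.1.1 i.1.2.2 U₀) e' : (Matrix (Fin 2) (Fin 2) ℂ)ˣ) : Matrix (Fin 2) (Fin 2) ℂ) * cf e'.tgt *
        (((emlIterU (i.1.2.2 - i.1.2.1) (bgUnits i.1.1 i.1.2.2 U₀) e')⁻¹ : (Matrix (Fin 2) (Fin 2) ℂ)ˣ) : Matrix (Fin 2) (Fin 2) ℂ)) →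
        ∃ l₀ : Site (i.1.1.P i.1.2.2) 0 → Matrix (Fin 2) (Fin 2) ℂ,
        (∀ b' : PBond (i.1.1.P i.1.2.2) 0, l₀ b'.src = ((bgUnits i.1.1 i.1.2.2 U₀ b' : (Matrix (Fin 2) (Fin 2) ℂ)ˣ) : Matrix (Fin 2) (Fin 2) ℂ) * l₀ b'.tgt * (((bgUnits i.1.1 i.1.2.2 U₀ b')⁻¹ : (Matrix (Fin 2) (Fin 2) ℂ)ˣ) : Matrix (Fin 2) (Fin 2) ℂ)) ∧
        ∀ y : Site (i.1.1.P i.1.2.2) (i.1.2.2 - i.1.2.1), l₀ (embIter (i.1.2.2 - i.1.2.1) y) = cf y) →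
      ∀ a : ℝ, a₀ * (c₀ L / cB L) * ((i.1.1.L : ℝ) ^ (i.1.2.2 - i.1.2.1)) ^ 3 ≤ a → a ≤ a₁ * (c₀ L / cB L) * ((i.1.1.L : ℝ) ^ (i.1.2.2 - i.1.2.1)) ^ 3 →
      (∀ (X : PBond (i.1.1.P i.1.2.2) 0 → Matrix (Fin 2) (Fin 2) ℂ) (s : ℝ), (∀ b, ‖X b‖ ≤ s) →
        ∀ bd : PBond (i.1.1.P i.1.2.2) 0,
          ‖(toL2 i.1.1 i.1.2.2 (c₀ L)).symm (GT i.1.1 i.1.2.1 i.1.2.2 i.2.2.le (c₀ L) (cB L) a (DeltaEtaSlot i.1.1 i.1.2.1 i.1.2.2 (c₀ L)) U₀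
              (toL2 i.1.1 i.1.2.2 (c₀ L) X)) bd‖
            ≤ BV L * s) ∧
      (∀ (X : PBond (i.1.1.P i.1.2.2) 0 → Matrix (Fin 2) (Fin 2) ℂ) (s : ℝ), (∀ b, ‖X b‖ ≤ s) →
        ∀ x : Site (i.1.1.P i.1.2.2) 0,
          ‖(toL2S i.1.1 i.1.2.2 (c₀ L)).symm (DstarL2 i.1.1 i.1.2.1 i.1.2.2 (c₀ L) U₀ (GT i.1.1 i.1.2.1 i.1.2.2 i.2.2.le (c₀ L) (cB L) a
              (DeltaEtaSlot i.1.1 i.1.2.1 i.1.2.2 (c₀ L)) U₀ (toL2 i.1.1 i.1.2.2 (c₀ L) X))) x‖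
            ≤ BD L * s) := by
  obtain ⟨αV, BV, hαV, hV1, hV2, hV3, hBV, hmemV⟩ := value_GT_DeltaEtaSlot_sup_family c₀ cB ha₀ ha₀₁
  obtain ⟨αD, BD, hαD, -, -, -, hBD, hmemD⟩ := divergence_GT_DeltaEtaSlot_sup_family_allMembers c₀ cB ha₀ ha₀₁
  refine ⟨fun L => min (αV L) (αD L), BV, BD, fun L hL => lt_min (hαV L hL) (hαD L hL), fun L hL => ?_, fun L hL => ?_, fun L hL => ?_, hBV, hBD, ?_⟩
  · exact (mul_le_mul_of_nonneg_left (min_le_left _ _) (by positivity)).trans (hV1 L hL)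
  · exact (mul_le_mul_of_nonneg_left (min_le_left _ _) (by positivity)).trans (hV2 L hL)
  · exact (mul_le_mul_of_nonneg_left (min_le_left _ _) (by positivity)).trans (hV3 L hL)
  intro L hL i U₀ ρ hreg hρ hlift a ha₀a ha₁a
  exact ⟨hmemV L hL i U₀ ρ hreg (hρ.trans (min_le_left _ _)) hlift a ha₀a ha₁a,
    hmemD L hL i U₀ ρ hreg (hρ.trans (min_le_right _ _)) hlift a ha₀a ha₁a⟩

end Summit.QuantumFields.YangMills.Theorems.Prop7OneFormGreenSupRowsAllMembers

end
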